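/-
Copyright: literature port (parity-ideate cell, ROUND-22/24 Phase B).  Trunk: AntSieve / parity.S13.
-/
import Literature.NumberTheory.Sieve.PolymathBoundedGapsCert
import HarnessLib

/-!
# The Dirichlet simplex functional `Λ_{n,c,r}` from SIGNED integer digits — a kernel Horner evaluator

D. H. J. Polymath, *Variants of the Selberg sieve, and bounded intervals containing many primes*, Res. Math. Sci. 1:12
(2014) = arXiv:1407.4897, Lemma 7.2 / Lemma 4.4: every `I`/`J` integral of the §7 test functions is a value of the
linear functional `Λ_{n,c,r}(X^N) = c!/(N+n+c)! · r^{N+n+c}` (`simplexFunctional`, `PolymathBoundedGapsCert`) at a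
polynomial with rational coefficients.  The tree's product-radial checker (`PolymathProdRadialCert.Zval`) evaluates it by
a Horner pass over NATURAL digits with an even/odd sign convention (valid for alternating profiles).  This file is the
sign-agnostic twin: the digits are integers `d_K` (e.g. decoded from a signed Kronecker pack,
`KroneckerSignedDigits.coeff_eq_kdigit_sub`), and

* `hornerZ`/`ZvalZ d rn rd a L` — ONE structural pass computing
  `Z = Σ_{K<L} d_K rn^K Π_{K<j<L} rd·(j+a)` (`ZvalZ_eq`);
* **`simplexFunctional_eq_ZvalZ`** — for `p : ℝ[X]` with `deg p ≤ L` and `p_K = d_K / D` (`K ≤ L`):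
  `Λ_{n,c,rn/rd}(p) = c! · rn^{n+c} · Z / (D · rd^{L+n+c} · (L+n+c)!)` with `Z = ZvalZ d rn rd (n+c) (L+1)` — an exact
  rational, so a certificate only has to compare integers.

Pure arithmetic + the one bridge theorem; no numerics, no named facts.

## References
* D. H. J. Polymath, Res. Math. Sci. 1 (2014), Art. 12; arXiv:1407.4897: Lemma 7.2, Lemma 4.4, Theorem 3.13. [Polymath8b2014]
-/

open Polynomial
open scoped BigOperators

namespace Literature.NumberTheory.Sieve.PolymathCert

/-! ### The program -/

section KernelProgram

/-- One Horner pass over signed digits `d N, …, d (N+fuel−1)` with state `(rp = rn^N, acc)`: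
`acc ← acc·rd·(N+a) + d_N·rn^N`. [cite: Polymath8b2014, Theorem 3.13, eq. (35)] -/
def hornerZ (d : ℕ → ℤ) (rn rd a : ℕ) : ℕ → ℕ → ℤ → ℤ → ℤ
  | 0, _, _, acc => acc
  | fuel + 1, N, rp, acc => hornerZ d rn rd a fuel (N + 1) (rp * rn) (acc * ((rd : ℤ) * (N + a)) + d N * rp)

/-- **The signed Horner value** `Z = Σ_{K<L} d_K rn^K Π_{K<j<L} rd (j+a)`. [cite: Polymath8b2014, Theorem 3.13, eq. (35)] -/
def ZvalZ (d : ℕ → ℤ) (rn rd a L : ℕ) : ℤ := hornerZ d rn rd a L 0 1 0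

end KernelProgram

/-! ### Specification -/

/-- The Horner invariant. [folklore] -/
private theorem hornerZ_inv (d : ℕ → ℤ) (rn rd a : ℕ) :
    ∀ fuel N : ℕ, ∀ acc : ℤ,
      hornerZ d rn rd a fuel N ((rn : ℤ) ^ N) acc =
        acc * ∏ j ∈ Finset.Ico N (N + fuel), ((rd : ℤ) * (j + a)) +
          ∑ K ∈ Finset.Ico N (N + fuel), d K * (rn : ℤ) ^ K *
            ∏ j ∈ Finset.Ico (K + 1) (N + fuel), ((rd : ℤ) * (j + a)) := by
  intro fuel
  induction fuel with
  | zero => intro N acc; simp [hornerZ]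
  | succ fuel ih =>
    intro N acc
    simp only [hornerZ]
    rw [← pow_succ, ih (N + 1), show N + (fuel + 1) = N + 1 + fuel by ring,
      Finset.prod_eq_prod_Ico_succ_bot (show N < N + 1 + fuel by omega),
      Finset.sum_eq_sum_Ico_succ_bot (show N < N + 1 + fuel by omega)]
    ring

/-- **Closed form** of the signed Horner value. [cite: Polymath8b2014, Theorem 3.13, eq. (35)] -/
theorem ZvalZ_eq (d : ℕ → ℤ) (rn rd a L : ℕ) :
    ZvalZ d rn rd a L = ∑ K ∈ Finset.range L, d K * (rn : ℤ) ^ K *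
      ∏ j ∈ Finset.Ico (K + 1) L, ((rd : ℤ) * (j + a)) := by
  have h := hornerZ_inv d rn rd a L 0 0
  rw [pow_zero, zero_add] at h
  rw [ZvalZ, h, Finset.range_eq_Ico]
  simp

/-- `ZvalZ` only reads the digits below `L`. [cite: Polymath8b2014, Theorem 3.13, eq. (35)] -/
theorem ZvalZ_congr {d d' : ℕ → ℤ} {rn rd a L : ℕ} (h : ∀ K < L, d K = d' K) :
    ZvalZ d rn rd a L = ZvalZ d' rn rd a L := by
  rw [ZvalZ_eq, ZvalZ_eq]
  exact Finset.sum_congr rfl fun K hK => by rw [h K (Finset.mem_range.1 hK)]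

/-- The factorial telescoping `Π_{K<j≤L'} (j+a) · (K+a)! = (L'+a)!`. [folklore] -/
private theorem prod_Ico_mul_factorial' (a K : ℕ) : ∀ L', K ≤ L' →
    (∏ j ∈ Finset.Ico (K + 1) (L' + 1), (j + a)) * (K + a).factorial = (L' + a).factorial := by
  intro L'
  induction L' with
  | zero =>
    intro h
    obtain rfl : K = 0 := by omega
    simp
  | succ L ih =>
    intro h
    rcases Nat.eq_or_lt_of_le h with rfl | hlt
    · simp
    · rw [Finset.prod_Ico_succ_top (by omega : K + 1 ≤ L + 1), mul_right_comm, ih (by omega),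
        show L + 1 + a = (L + a) + 1 by ring, Nat.factorial_succ]
      ring

/-- Real form of the Horner products: `Π_{K<j≤L'} rd (j+a) = rd^{L'−K} (L'+a)!/(K+a)!`. [folklore] -/
private theorem prod_Ico_real' (rd a K L' : ℕ) (hK : K ≤ L') :
    ∏ j ∈ Finset.Ico (K + 1) (L' + 1), ((rd : ℝ) * ((j : ℝ) + a)) =
      (rd : ℝ) ^ (L' - K) * ((L' + a).factorial : ℝ) / ((K + a).factorial : ℝ) := by
  rw [Finset.prod_mul_distrib, Finset.prod_const, Nat.card_Ico, show L' + 1 - (K + 1) = L' - K by omega,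
    eq_div_iff (by positivity)]
  have h := prod_Ico_mul_factorial' a K L' hK
  have h' : (∏ j ∈ Finset.Ico (K + 1) (L' + 1), ((j : ℝ) + a)) * ((K + a).factorial : ℝ) =
      ((L' + a).factorial : ℝ) := by exact_mod_cast h
  rw [mul_assoc, h']

/-- The signed Horner value, real form. [folklore] -/
private theorem ZvalZ_real (d : ℕ → ℤ) (rn rd a L : ℕ) :
    (ZvalZ d rn rd a L : ℝ) = ∑ K ∈ Finset.range L, (d K : ℝ) * (rn : ℝ) ^ K *
      ∏ j ∈ Finset.Ico (K + 1) L, ((rd : ℝ) * ((j : ℝ) + a)) := by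
  rw [ZvalZ_eq]; push_cast; rfl

/-! ### The bridge to `Λ_{n,c,r}` -/

/-- **`Λ_{n,c,rn/rd}(p)` from signed integer digits**: if `deg p ≤ L` and `p_K = d_K / D` for `K ≤ L`, then
`Λ_{n,c,rn/rd}(p) = c! · rn^{n+c} · ZvalZ d rn rd (n+c) (L+1) / (D · rd^{L+n+c} · (L+n+c)!)`.
[cite: Polymath8b2014, Lemma 4.4] -/
theorem simplexFunctional_eq_ZvalZ (p : ℝ[X]) (d : ℕ → ℤ) {D : ℝ} (hD : D ≠ 0) (n c rn rd L : ℕ)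
    (hrd : 0 < rd) (hdeg : p.natDegree ≤ L) (hcoef : ∀ K ≤ L, p.coeff K = (d K : ℝ) / D) :
    simplexFunctional n c ((rn : ℝ) / rd) p =
      (c.factorial : ℝ) * (rn : ℝ) ^ (n + c) * (ZvalZ d rn rd (n + c) (L + 1) : ℝ) /
        (D * (rd : ℝ) ^ (L + (n + c)) * ((L + (n + c)).factorial : ℝ)) := by
  have hrd' : (rd : ℝ) ≠ 0 := by positivity
  rw [simplexFunctional_eq_sum_range n c _ p (Nat.lt_succ_of_le hdeg), ZvalZ_real, Finset.mul_sum, Finset.sum_div]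
  refine Finset.sum_congr rfl fun K hK => ?_
  have hKL : K ≤ L := Nat.lt_succ_iff.1 (Finset.mem_range.1 hK)
  rw [hcoef K hKL, simplexWeight, prod_Ico_real' rd (n + c) K L hKL]
  have hpow : (rd : ℝ) ^ (L + (n + c)) = (rd : ℝ) ^ K * (rd : ℝ) ^ (L - K) * (rd : ℝ) ^ (n + c) := by
    rw [← pow_add, ← pow_add]; congr 1; omega
  rw [hpow, show K + n + c = K + (n + c) by ring, div_pow, pow_add, pow_add]
  have hf1 : ((K + (n + c)).factorial : ℝ) ≠ 0 := by positivity
  have hf2 : ((L + (n + c)).factorial : ℝ) ≠ 0 := by positivity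
  field_simp
  ring

end Literature.NumberTheory.Sieve.PolymathCert
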